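import Literature.AlgebraicGeometry.Frobenioids.PerfectionModelFunctor
import HarnessLib

/-!
# Frobenioids I, Prop. 5.5 (iv) for `C^pf` of a model Frobenioid, III: the comparison functor is an
# equivalence; the slot `FrdI.Prop55Sub.Prop55iv_pf`

Mochizuki, *The geometry of Frobenioids I: the general theory*, Kyushu J. Math. **62** (2008)
293–400, Proposition 5.5 (iv) p. 104: "If `C` is the model Frobenioid associated to data
`Φ, B, Div_B : B → Φ^gp`, then there is a natural equivalence of categories [compatible with the functors to
the respective elementary Frobenioids] between `C^pf` … and the model Frobenioid associated to the data
`Φ^pf, B^pf, B^pf → (Φ^gp)^pf`"; proof p. 105 ll. 26–27: "immediate from the definitions"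
[cite: MochizukiFrdI2008, Prop. 5.5 (iv) p.104].

Sub-node FrdI:Prop5.5(iv)/P55-L08, `C^pf` row, THIRD PART.  The functor `toModelPf`
(`PerfectionModelFunctor.lean`) is

* FAITHFUL (`toModelPf_faithful`): two representatives at a common level with the same image data have,
  after a further transport multiplying the level by a suitable `t` (killing the `N`-torsion ambiguity of the
  classes in `Φ^pf`, `B^pf`), equal degree, base, divisor and unit (Thm. 5.2 (i): a morphism of a model
  Frobenioid IS this quadruple), hence equal classes;
* FULL (`toModelPf_full`): a quadruple `(d, β, x^{1/k}, u^{1/k'})` satisfying relation (d) in `(Φ^pf)^gp` comes,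
  after clearing roots and denominators (kernel criterion `gpToPf_eq_iff`, `Φ(A_D)` integral), from an explicit
  arrow `A^{(a)} → A'^{(b)}` of `C` at a high enough level;
* ESSENTIALLY SURJECTIVE (`toModelPf_essSurj`): every class of `(Φ^pf(A_D))^gp` is `(ι α)^{1/n}`
  (`exists_eq_gpRoot_gpToPf`), the image of `((A_D, α), n)` on the nose.
Hence an equivalence (`toModelPf_isEquivalence`) lying over `D` — **`prop55iv_pf_holds`** closes the slot
`FrdI.Prop55Sub.Prop55iv_pf` of `Prop55Sub.lean` for THE perfection (print's antecedents "Frobenius-isotropic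
and Frobenius-normalized type" are not used).
-/

namespace Literature.AlgebraicGeometry.Frobenioids

namespace PreFrobenioid

namespace Perfection

namespace ModelPf

open CategoryTheory Opposite

universe w v u

variable {D : Type u} [Category.{v} D] {Φ B : Dᵒᵖ ⥤ CommMonCat.{w}} {DivB : B ⟶ monoidGp Φ}
  {hF : IsFrobenioid (ModelFrobenioid.toElem Φ B DivB)} {X Y : Perfection hF}

/-! ### Transport of a representative: the four components -/

/-- The degree of the Frobenius transition at the target of a transport `(a, b) ≤ (a t, b t)` is `t`.
[cite: MochizukiFrdI2008, Def. 3.1 (iii) p.57] -/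
theorem degFr_frobTrans_eq (L L' : Level X Y) (h : L.LE L') (t : ℕ+) (ht : L'.a = L.a * t) :
    ModelFrobenioid.degFr (frobTrans hF Y.obj h.2) = t := by
  have e : degFr (ModelFrobenioid.toElem Φ B DivB) (frobTrans hF Y.obj h.2) = t := by
    rw [← L.degFr_eq L' h]
    exact mul_left_cancel ((degFr_frobTrans hF X.obj h.1).trans ht)
  exact e

/-- Transport preserves the degree. [cite: MochizukiFrdI2008, Prop. 1.10 (i) p.34] -/
theorem degFr_liftRep (L L' : Level X Y) (h : L.LE L') (θ : L.HomAt) :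
    ModelFrobenioid.degFr (L.lift L' h θ) = ModelFrobenioid.degFr θ :=
  degFr_frobeniusConjugate (L.lift_spec L' h θ) (L.degFr_eq L' h)

/-- Transport and `Base`: `Base(τ_A) ≫ Base(θ') = Base(θ) ≫ Base(τ_{A'})`.
[cite: MochizukiFrdI2008, Prop. 1.10 (i) p.34] -/
theorem baseMap_liftRep (L L' : Level X Y) (h : L.LE L') (θ : L.HomAt) :
    ModelFrobenioid.baseMap (frobTrans hF X.obj h.1) ≫ ModelFrobenioid.baseMap (L.lift L' h θ) =
      ModelFrobenioid.baseMap θ ≫ ModelFrobenioid.baseMap (frobTrans hF Y.obj h.2) := by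
  have := congrArg ModelFrobenioid.baseMap (L.lift_spec L' h θ)
  rwa [ModelFrobenioid.baseMap_comp, ModelFrobenioid.baseMap_comp] at this

/-- Transport and `Div`: `Div(θ') = ((Base τ_A)^{-1 *} Div(θ))^t`. [cite: MochizukiFrdI2008, Prop. 1.10 (i) p.34] -/
theorem div_liftRep (L L' : Level X Y) (h : L.LE L') (θ : L.HomAt) (t : ℕ+) (ht : L'.a = L.a * t) :
    haveI := isIso_baseMap_frob (hF := hF) X.obj L.a
    haveI : IsIso (ModelFrobenioid.baseMap (frobTrans hF X.obj h.1)) :=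
      ModelFrobenioid.isIso_baseMap_of_isFrobeniusType (isFrobeniusType_frobTrans hF X.obj h.1)
    ModelFrobenioid.div (L.lift L' h θ) =
      pull Φ (CategoryTheory.inv (ModelFrobenioid.baseMap (frobTrans hF X.obj h.1))) (ModelFrobenioid.div θ) ^ (t : ℕ) := by
  have e := div_frobeniusConjugate (F := ModelFrobenioid.toElem Φ B DivB) (L.lift_spec L' h θ)
    (isFrobeniusType_frobTrans hF X.obj h.1) (isFrobeniusType_frobTrans hF Y.obj h.2)
  rw [← degFr_frobTrans_eq L L' h t ht]
  exact e

/-- Transport and units: `Base(τ_A)^* u_{θ'} · u_{τ_A}^{deg θ} = Base(θ)^* u_{τ_{A'}} · u_θ^t`.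
[cite: MochizukiFrdI2008, Thm. 5.2 (i) p.100] -/
theorem unit_liftRep (L L' : Level X Y) (h : L.LE L') (θ : L.HomAt) (t : ℕ+) (ht : L'.a = L.a * t) :
    pull B (ModelFrobenioid.baseMap (frobTrans hF X.obj h.1)) (ModelFrobenioid.unit (L.lift L' h θ)) *
        ModelFrobenioid.unit (frobTrans hF X.obj h.1) ^ (ModelFrobenioid.degFr θ : ℕ) =
      pull B (ModelFrobenioid.baseMap θ) (ModelFrobenioid.unit (frobTrans hF Y.obj h.2)) *
        ModelFrobenioid.unit θ ^ (t : ℕ) := by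
  have e := ModelFrobenioid.unit_square (L.lift_spec L' h θ)
  rwa [degFr_liftRep, degFr_frobTrans_eq L L' h t ht] at e

/-! ### Faithfulness -/

/-- `Base(θ)` is recovered from `Base(r) = Base(frob_A) ≫ Base(θ) ≫ Base(frob_{A'})⁻¹`.
[cite: MochizukiFrdI2008, Prop. 3.2 (i) p.58] -/
theorem baseMap_eq_of_mbase_eq {L : Level X Y} {θ₁ θ₂ : L.HomAt}
    (h : Rep.mbase X Y ⟨L, θ₁⟩ = Rep.mbase X Y ⟨L, θ₂⟩) :
    ModelFrobenioid.baseMap θ₁ = ModelFrobenioid.baseMap θ₂ := by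
  haveI := isIso_baseMap_frob (hF := hF) X.obj L.a
  have e₁ := mbase_comp (X := X) (Y := Y) ⟨L, θ₁⟩
  have e₂ := mbase_comp (X := X) (Y := Y) ⟨L, θ₂⟩
  rw [h] at e₁
  exact (cancel_epi (ModelFrobenioid.baseMap (frob hF X.obj L.a))).mp (e₁.symm.trans e₂)

/-- Two representatives AT ONE LEVEL whose images under the comparison functor agree define the same perfected
morphism: after transport by a suitable factor `t` the degree, base, divisor and unit agree.
[cite: MochizukiFrdI2008, Prop. 5.5 (iv) p.104] -/
theorem mk_eq_mk_of_data_eq (hB : Objectwise (fun M _ => IsGroupLike M) B) {L : Level X Y} {θ₁ θ₂ : L.HomAt}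
    (hd : ModelFrobenioid.degFr θ₁ = ModelFrobenioid.degFr θ₂)
    (hb : Rep.mbase X Y ⟨L, θ₁⟩ = Rep.mbase X Y ⟨L, θ₂⟩)
    (hx : Rep.pdiv (⟨L, θ₁⟩ : Rep X Y) = Rep.pdiv (⟨L, θ₂⟩ : Rep X Y))
    (hu : unitPf hB ⟨L, θ₁⟩ = unitPf hB ⟨L, θ₂⟩) :
    (Hom.mk ⟨L, θ₁⟩ : X ⟶ Y) = Hom.mk ⟨L, θ₂⟩ := by
  -- the `N`-torsion ambiguities
  rw [Rep.pdiv_eq, Rep.pdiv_eq, Frobenioids.Perfection.mk_eq_mk_iff] at hx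
  obtain ⟨N₁, hN₁⟩ := hx
  unfold unitPf at hu
  rw [Frobenioids.Perfection.mk_eq_mk_iff] at hu
  obtain ⟨N₂, hN₂⟩ := hu
  -- the common level `(a t, b t)`, `t = N₁ (n a) N₂ (n a)`
  set t : ℕ+ := N₁ * (X.idx * L.a) * (N₂ * (X.idx * L.a)) with ht
  let L' : Level X Y := ⟨L.a * t, L.b * t, by rw [← mul_assoc, L.eq, mul_assoc]⟩
  have hle : L.LE L' := ⟨dvd_mul_right _ _, dvd_mul_right _ _⟩
  rw [← Hom.mk_lift ⟨L, θ₁⟩ L' hle, ← Hom.mk_lift ⟨L, θ₂⟩ L' hle]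
  -- it suffices that the transported representatives agree
  suffices e : L.lift L' hle θ₁ = L.lift L' hle θ₂ by
    change Hom.mk ⟨L', L.lift L' hle θ₁⟩ = Hom.mk ⟨L', L.lift L' hle θ₂⟩
    rw [e]
  have hbase := baseMap_eq_of_mbase_eq hb
  haveI : IsIso (ModelFrobenioid.baseMap (frobTrans hF X.obj hle.1)) :=
    ModelFrobenioid.isIso_baseMap_of_isFrobeniusType (isFrobeniusType_frobTrans hF X.obj hle.1)
  haveI := isIso_baseMap_frob (hF := hF) X.obj L.a
  -- divisors: `(Div θ₁)^t = (Div θ₂)^t`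
  have hdiv : ModelFrobenioid.div θ₁ ^ (t : ℕ) = ModelFrobenioid.div θ₂ ^ (t : ℕ) := by
    have e : ModelFrobenioid.div θ₁ ^ ((N₁ : ℕ) * ((X.idx * L.a : ℕ+) : ℕ)) =
        ModelFrobenioid.div θ₂ ^ ((N₁ : ℕ) * ((X.idx * L.a : ℕ+) : ℕ)) := by
      apply pull_injective (Φ := Φ) (ModelFrobenioid.baseMap (frob hF X.obj L.a))
      rw [map_pow, map_pow]
      exact hN₁
    have et : (t : ℕ) = ((N₁ : ℕ) * ((X.idx * L.a : ℕ+) : ℕ)) * ((N₂ * (X.idx * L.a) : ℕ+) : ℕ) := by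
      rw [ht, PNat.mul_coe, PNat.mul_coe]
    rw [et, pow_mul, e, ← pow_mul]
  -- units: `u_{θ₁}^t = u_{θ₂}^t`
  have hunit : ModelFrobenioid.unit θ₁ ^ (t : ℕ) = ModelFrobenioid.unit θ₂ ^ (t : ℕ) := by
    have e : ModelFrobenioid.unit θ₁ ^ ((N₂ : ℕ) * ((X.idx * L.a : ℕ+) : ℕ)) =
        ModelFrobenioid.unit θ₂ ^ ((N₂ : ℕ) * ((X.idx * L.a : ℕ+) : ℕ)) := by
      apply pull_injective (Φ := B) (ModelFrobenioid.baseMap (frob hF X.obj L.a))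
      rw [map_pow, map_pow]
      -- `unitB θ₁ ^ K = unitB θ₂ ^ K`, and `unitB θ = Base^* u_θ · (common units)`
      have k₁ := unitB_mul hB (⟨L, θ₁⟩ : Rep X Y)
      have k₂ := unitB_mul hB (⟨L, θ₂⟩ : Rep X Y)
      change unitB hB ⟨L, θ₁⟩ * pull B (Rep.mbase X Y ⟨L, θ₁⟩) (ModelFrobenioid.unit (frob hF Y.obj L.b)) =
        pull B (ModelFrobenioid.baseMap (frob hF X.obj L.a)) (ModelFrobenioid.unit θ₁) *
          ModelFrobenioid.unit (frob hF X.obj L.a) ^ (ModelFrobenioid.degFr θ₁ : ℕ) at k₁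
      change unitB hB ⟨L, θ₂⟩ * pull B (Rep.mbase X Y ⟨L, θ₂⟩) (ModelFrobenioid.unit (frob hF Y.obj L.b)) =
        pull B (ModelFrobenioid.baseMap (frob hF X.obj L.a)) (ModelFrobenioid.unit θ₂) *
          ModelFrobenioid.unit (frob hF X.obj L.a) ^ (ModelFrobenioid.degFr θ₂ : ℕ) at k₂
      rw [hb, hd] at k₁
      apply (hB X.obj.base).mul_right_cancel
        ((ModelFrobenioid.unit (frob hF X.obj L.a) ^ (ModelFrobenioid.degFr θ₂ : ℕ)) ^ ((N₂ : ℕ) * ((X.idx * L.a : ℕ+) : ℕ)))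
      rw [← mul_pow, ← mul_pow, ← k₁, ← k₂, mul_pow, mul_pow, hN₂]
    have et : (t : ℕ) = ((N₂ : ℕ) * ((X.idx * L.a : ℕ+) : ℕ)) * ((N₁ * (X.idx * L.a) : ℕ+) : ℕ) := by
      rw [ht, PNat.mul_coe, mul_comm, PNat.mul_coe]
    rw [et, pow_mul, e, ← pow_mul]
  -- assemble
  apply ModelFrobenioid.hom_ext
  · rw [degFr_liftRep, degFr_liftRep, hd]
  · apply (cancel_epi (ModelFrobenioid.baseMap (frobTrans hF X.obj hle.1))).mp
    rw [baseMap_liftRep, baseMap_liftRep, hbase]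
  · rw [div_liftRep L L' hle θ₁ t rfl, div_liftRep L L' hle θ₂ t rfl, ← map_pow, ← map_pow, hdiv]
  · have e₁ := unit_liftRep L L' hle θ₁ t rfl
    have e₂ := unit_liftRep L L' hle θ₂ t rfl
    rw [hd, hbase, hunit, ← e₂] at e₁
    exact pull_injective (Φ := B) (ModelFrobenioid.baseMap (frobTrans hF X.obj hle.1))
      ((hB _).mul_right_cancel _ e₁)

variable (DivBpf : perfectionFunctor B ⟶ monoidGp (perfectionFunctor Φ))
  (hB : Objectwise (fun M _ => IsGroupLike M) B) (hDiv : IsPerfectedDiv Φ B DivB DivBpf)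

/-- **The comparison functor is faithful.** [cite: MochizukiFrdI2008, Prop. 5.5 (iv) p.104] -/
theorem toModelPf_faithful : (toModelPf hF DivBpf hB hDiv).Faithful := by
  refine ⟨fun {X Y} f g hfg => ?_⟩
  obtain ⟨r, rfl⟩ := Hom.mk_surjective f
  obtain ⟨s, rfl⟩ := Hom.mk_surjective g
  -- a common level
  let M := r.L.sup s.L
  rw [← Hom.mk_lift r M (Level.le_sup_left _ _), ← Hom.mk_lift s M (Level.le_sup_right _ _)] at hfg ⊢
  have h₁ := congrArg ModelFrobenioid.degFr hfg
  have h₂ := congrArg ModelFrobenioid.baseMap hfg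
  have h₃ := congrArg ModelFrobenioid.div hfg
  have h₄ := congrArg ModelFrobenioid.unit hfg
  exact mk_eq_mk_of_data_eq hB h₁ h₂ h₃ h₄

/-! ### Essential surjectivity -/

/-- **The comparison functor is surjective on objects** on the nose: `(A_D, (ι α)^{1/n})` is the image of
`((A_D, α), n)`, and every class of `(Φ^pf(A_D))^gp` has this form. [cite: MochizukiFrdI2008, Prop. 5.5 (iv) p.104] -/
theorem toModelPf_obj_surjective (W : ModelFrobenioid (perfectionFunctor Φ) (perfectionFunctor B) DivBpf) :
    ∃ X : Perfection hF, (toModelPf hF DivBpf hB hDiv).obj X = W := by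
  obtain ⟨A, ζ⟩ := W
  obtain ⟨n, x, rfl⟩ := exists_eq_gpRoot_gpToPf (M := Φ.obj (op A)) ζ
  exact ⟨⟨⟨A, x⟩, n⟩, rfl⟩

/-- **The comparison functor is essentially surjective.** [cite: MochizukiFrdI2008, Prop. 5.5 (iv) p.104] -/
theorem toModelPf_essSurj : (toModelPf hF DivBpf hB hDiv).EssSurj where
  mem_essImage W := by
    obtain ⟨X, hX⟩ := toModelPf_obj_surjective DivBpf hB hDiv W
    exact ⟨X, ⟨eqToIso hX⟩⟩

end ModelPf

end Perfection

end PreFrobenioid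

end Literature.AlgebraicGeometry.Frobenioids
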